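import Literature.NumberTheory.Transcendental.LinGroupZEIdeals
import Literature.NumberTheory.Transcendental.LinGroupZEMultiplicity
import Literature.NumberTheory.Transcendental.LinGroupZEChain
import Literature.NumberTheory.Transcendental.LinGroupZESubgroups
import Literature.NumberTheory.Transcendental.LinGroupZELeibniz
import Literature.NumberTheory.Transcendental.PhilipponZeroEstimateTransversal
import Mathlib.LinearAlgebra.Dual.Lemmas
import HarnessLib

/-!
# Philippon's zero estimate on `𝔾ₐ^{d₀} × 𝔾ₘ^{d₁}`: Prop. 3.8, Steps 1 and 2

## Philippon's zero estimate on `𝔾ₐ^{d₀} × 𝔾ₘ^{d₁}`: Prop. 3.8, Step 1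

Topic `Literature/NumberTheory/Transcendental`. Port to `LinGroup d₀ d₁` (index `Fin d₀ ⊕ Fin d₁`)
of the tree's `PhilipponZeroEstimateStep1.lean` (the case `d₀ = 1`), for the zero estimate owed to
`Literature.Barriers.Schanuel.roy1992_thm1`: Step 1 of D. Roy's proof of the
multiplicity estimate Prop. 3.8 (Nesterenko–Philippon (eds.), LNM 1752, Ch. 11, p. 216), in the
affine ring `B = ℂ[X₁, …, X_{d₀}, Y₁, …, Y_{d₁}]`. If every word of length `≤ T` in the invariant derivations
`D_u`, `u ∈ W`, maps the ideal `𝔄` into the prime `𝔭` (equivalently `∂^T(𝔄) ⊆ 𝔭`,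
`wordDeriv_mem_of_dIdeal_le`), then the same holds for the component
`𝔮 = loc 𝔭 𝔄 = 𝔄·B_𝔭 ∩ B` of `𝔄` at `𝔭` (`…Loc.lean`): for `f ∈ 𝔮` with `P f ∈ 𝔄`, `P ∉ 𝔭`, the
product rule and induction on the length give `P · D_u f ∈ 𝔭`, hence `D_u f ∈ 𝔭`. PROVED:

* `iterate_invDeriv_mem_wordsLE`, `opPow_mem_wordsLE` — the monomials `D^μ` of
  `…Multiplicity.lean` are words of length `|μ|`;
* **`wordDeriv_mem_of_mem_loc`** (Step 1) and its `D^μ`-form `opPow_mem_of_mem_loc`, the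
  hypothesis `H𝔮` of `…Independence.lean`;
* `wordDeriv_mem_of_dIdeal_le` — the hypothesis from `∂^T_{e}(𝔄) ≤ 𝔭`.

## Philippon's zero estimate on `𝔾ₐ^{d₀} × 𝔾ₘ^{d₁}`: Prop. 3.8, Step 2 (transversal data at a coset)

Topic `Literature/NumberTheory/Transcendental`. Port to `LinGroup d₀ d₁` (index `Fin d₀ ⊕ Fin d₁`)
of the tree's `PhilipponZeroEstimateTransversal.lean` (the case `d₀ = 1`), for the zero estimate
owed to `Literature.Barriers.Schanuel.roy1992_thm1`: Step 2 of D. Roy's proof of the multiplicity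
estimate Prop. 3.8 (Nesterenko–Philippon (eds.), LNM 1752, Ch. 11, pp. 216–217) for
`G = 𝔾ₐ^{d₀} × 𝔾ₘ^{d₁}`, made explicit. Roy chooses local equations of the coset `𝒱 = σ·H₀` and
tangent vectors `∂₁, …, ∂_s ∈ W` representing a basis of `(W + T_{H₀})/T_{H₀}` with
`∂ᵢ g_j ≡ δᵢⱼ (unit)` modulo `𝔭(𝒱)`. For an irreducible closed subgroup `H₀ = E × T_A`
(`LinGroup.toConnAlgSubgroup`, `LinGroupZESubgroups.lean`) the equations are global polynomials:
the linear equations `∑ φᵢ (Xᵢ - xᵢ(σ))`, `φ` a covector killing `E` (new for `d₀ > 1`: the double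
annihilator `mem_iff_forall_annihilator`), and the character binomials `Y^{χ⁺} - χ(σ) Y^{χ⁻}`,
`χ ∈ A`; their derivatives in the direction `w = (w₀, v)` are `φ(w₀)` and `⟨χ, v⟩·Y^{χ⁺}` modulo
`𝔭(𝒱)`, and the common kernel of these linear forms is the Lie algebra
`LinGroup.ConnAlgSubgroup.tangent`. PROVED:

* `GaGm.exists_dual_family` (REUSED from the `d₀ = 1` file) — linear algebra: from a set `𝓛` of linear forms on a finite-dimensional
  space with common kernel `T`, one can pick `k ≤ dim V - dim T` forms `λ_j ∈ 𝓛` and vectors `vᵢ`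
  with `λ_j(vᵢ) = δᵢⱼ`;
* `invDeriv_prod_X_pow`, `charBinomial`, `invDeriv_charBinomial_sub_mem` — the derivative
  computations;
* **`exists_transversal`** — for `H₀` irreducible closed, `σ ∈ G`, `W`, with
  `s = dim W - dim (W ∩ Lie H₀)`: vectors `w₁, …, w_s ∈ W` and polynomials
  `g₁, …, g_s ∈ 𝔭 = 𝔍(σ·H₀)` in a common box `Box(c)` with `D_{wᵢ} g_j ∈ 𝔭` (`i ≠ j`) and
  `D_{wᵢ} gᵢ ∉ 𝔭` — the data `hg/hoff/hdiag` of `…Multiplicity.lean` / `…Independence.lean`.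

## References

* Yu. V. Nesterenko, P. Philippon (eds.), *Introduction to Algebraic Independence Theory*,
  LNM 1752, Springer 2001, Ch. 11 (D. Roy), Prop. 3.8, Step 1 (p. 216).
* P. Philippon, *Lemmes de zéros dans les groupes algébriques commutatifs*, Bull. Soc. Math.
  France 114 (1986), 355–383, §4.
  LNM 1752, Springer 2001, Ch. 11 (D. Roy), Prop. 3.8, Step 2 (pp. 216–217).
  France 114 (1986), 355–383, Lemme 4.6.
-/
noncomputable section

open MvPolynomial

namespace Literature.NumberTheory.Transcendental

namespace LinGroup

open GaGm (order)

variable {d₀ d₁ : ℕ} {W : Submodule ℂ ((Fin d₀ → ℂ) × (Fin d₁ → ℂ))}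

/-! ### `D^μ` is a word -/

/-- Iterating one letter keeps inside `wordsLE`. [folklore] -/
theorem iterate_invDeriv_mem_wordsLE {N : ℕ} {g Q : MvPolynomial (Fin d₀ ⊕ Fin d₁) ℂ} (hQ : Q ∈ wordsLE W N g)
    {a : (Fin d₀ → ℂ) × (Fin d₁ → ℂ)} (ha : a ∈ W) (k : ℕ) : (invDeriv a)^[k] Q ∈ wordsLE W (k + N) g := by
  induction k with
  | zero => simpa using hQ
  | succ k ih =>
    rw [Function.iterate_succ_apply', show k + 1 + N = (k + N) + 1 by ring]
    exact invDeriv_mem_wordsLE ih ha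

/-- **`D^μ f` is a word of length `|μ|` in the letters `wᵢ ∈ W` applied to `f`.** [folklore] -/
theorem opPow_mem_wordsLE {s : ℕ} {w : Fin s → (Fin d₀ → ℂ) × (Fin d₁ → ℂ)} (hw : ∀ i, w i ∈ W) (μ : Fin s → ℕ)
    (f : MvPolynomial (Fin d₀ ⊕ Fin d₁) ℂ) : opPow w μ f ∈ wordsLE W (order μ) f := by
  induction s with
  | zero =>
    rw [opPow_zero]
    simpa [order] using self_mem_wordsLE W 0 f
  | succ s ih =>
    rw [opPow_succ]
    have h := iterate_invDeriv_mem_wordsLE (ih (fun i => hw i.succ) (Fin.tail μ)) (hw 0) (μ 0)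
    have hord : order μ = μ 0 + order (Fin.tail μ) := by
      simp only [order, Fin.sum_univ_succ]; rfl
    rwa [hord]

/-! ### Step 1 -/

/-- **Prop. 3.8, Step 1.** Let `𝔭` be prime and suppose every word of length `≤ T` (letters in
`W`) sends `𝔄` into `𝔭`. Then every such word sends the component `loc 𝔭 𝔄` into `𝔭`.
[cite: NesterenkoPhilippon2001, Ch. 11 Prop. 3.8 (Step 1)] -/
theorem wordDeriv_mem_of_mem_loc {𝔭 𝔄 : Ideal (MvPolynomial (Fin d₀ ⊕ Fin d₁) ℂ)} (h𝔭 : 𝔭.IsPrime) {T : ℕ}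
    (h𝔄 : ∀ f ∈ 𝔄, ∀ k ≤ T, ∀ v : Fin k → (Fin d₀ → ℂ) × (Fin d₁ → ℂ), (∀ i, v i ∈ W) → wordDeriv v f ∈ 𝔭)
    {f : MvPolynomial (Fin d₀ ⊕ Fin d₁) ℂ} (hf : f ∈ loc 𝔭 h𝔭 𝔄) :
    ∀ k ≤ T, ∀ v : Fin k → (Fin d₀ → ℂ) × (Fin d₁ → ℂ), (∀ i, v i ∈ W) → wordDeriv v f ∈ 𝔭 := by
  obtain ⟨P, hP, hPf⟩ := hf
  intro k
  induction k using Nat.strong_induction_on with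
  | _ k ih =>
    intro hk v hv
    have h1 : wordDeriv v (P * f) ∈ 𝔭 := h𝔄 _ hPf k hk v hv
    cases k with
    | zero =>
      have hv0 : v = Fin.elim0 := funext fun i => i.elim0
      subst hv0
      rw [wordDeriv_zero] at h1 ⊢
      exact (h𝔭.mem_or_mem h1).resolve_left hP
    | succ k =>
      have h2 := wordDeriv_mul_sub_mem_span v hv P f
      have h3 : Ideal.span (wordsLE W k f) ≤ 𝔭 := by
        rw [Ideal.span_le]
        rintro _ ⟨j, hj, u, hu, rfl⟩
        exact ih j (by omega) (by omega) u hu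
      have h4 : P * wordDeriv v f ∈ 𝔭 := by
        have := 𝔭.sub_mem h1 (h3 h2)
        rwa [sub_sub_cancel] at this
      exact (h𝔭.mem_or_mem h4).resolve_left hP

/-- **Step 1 in `D^μ`-form** (the hypothesis `H𝔮` of `…Independence.lean`): with `wᵢ ∈ W`,
`|μ| ≤ T` and `f ∈ loc 𝔭 𝔄`, `D^μ f ∈ 𝔭`. [cite: NesterenkoPhilippon2001, Ch. 11 Prop. 3.8 (Step 1)] -/
theorem opPow_mem_of_mem_loc {𝔭 𝔄 : Ideal (MvPolynomial (Fin d₀ ⊕ Fin d₁) ℂ)} (h𝔭 : 𝔭.IsPrime) {T : ℕ}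
    (h𝔄 : ∀ f ∈ 𝔄, ∀ k ≤ T, ∀ v : Fin k → (Fin d₀ → ℂ) × (Fin d₁ → ℂ), (∀ i, v i ∈ W) → wordDeriv v f ∈ 𝔭)
    {s : ℕ} {w : Fin s → (Fin d₀ → ℂ) × (Fin d₁ → ℂ)} (hw : ∀ i, w i ∈ W) :
    ∀ f ∈ loc 𝔭 h𝔭 𝔄, ∀ μ : Fin s → ℕ, order μ ≤ T → opPow w μ f ∈ 𝔭 := by
  intro f hf μ hμ
  obtain ⟨j, hj, u, hu, hju⟩ := opPow_mem_wordsLE hw μ f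
  rw [hju]
  exact wordDeriv_mem_of_mem_loc h𝔭 h𝔄 hf j (hj.trans hμ) u hu

/-- The hypothesis of Step 1 from `∂^T_{e}(𝔄) ≤ 𝔭`. [folklore] -/
theorem wordDeriv_mem_of_dIdeal_le {𝔭 𝔄 : Ideal (MvPolynomial (Fin d₀ ⊕ Fin d₁) ℂ)} {T : ℕ}
    (h : dIdeal W {(1 : LinGroup d₀ d₁)} T 𝔄 ≤ 𝔭) :
    ∀ f ∈ 𝔄, ∀ k ≤ T, ∀ v : Fin k → (Fin d₀ → ℂ) × (Fin d₁ → ℂ), (∀ i, v i ∈ W) → wordDeriv v f ∈ 𝔭 := by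
  intro f hf k hk v hv
  refine h (le_sat _ (Ideal.subset_span ⟨1, rfl, wordDeriv v f, ⟨f, hf, k, hk, v, hv, rfl⟩, ?_⟩))
  rw [shift_one]
  rfl

end LinGroup

end Literature.NumberTheory.Transcendental

noncomputable section

open MvPolynomial Module
open scoped Pointwise

namespace Literature.NumberTheory.Transcendental

namespace LinGroup

variable {d₀ d₁ : ℕ}

/-! ### Derivatives of the equations of a coset -/

/-- `D_w (∏ Y_j^{e_j}) = (∑ e_j v_j) · ∏ Y_j^{e_j}`. [folklore] -/
theorem invDeriv_prod_X_pow (w : (Fin d₀ → ℂ) × (Fin d₁ → ℂ)) (e : Fin d₁ → ℕ) :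
    invDeriv w (∏ j, (X (Sum.inr j) : MvPolynomial (Fin d₀ ⊕ Fin d₁) ℂ) ^ e j) =
      (∑ j, (e j : ℂ) * w.2 j) • ∏ j, (X (Sum.inr j) : MvPolynomial (Fin d₀ ⊕ Fin d₁) ℂ) ^ e j := by
  classical
  have key : ∀ S : Finset (Fin d₁), invDeriv w (∏ j ∈ S, (X (Sum.inr j) : MvPolynomial (Fin d₀ ⊕ Fin d₁) ℂ) ^ e j) =
      (∑ j ∈ S, (e j : ℂ) * w.2 j) • ∏ j ∈ S, (X (Sum.inr j) : MvPolynomial (Fin d₀ ⊕ Fin d₁) ℂ) ^ e j := by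
    intro S
    induction S using Finset.induction_on with
    | empty => simp
    | insert a S ha ih =>
      rw [Finset.prod_insert ha, Finset.sum_insert ha, Derivation.leibniz, ih, Derivation.leibniz_pow,
        invDeriv_X_inr, add_smul]
      simp only [smul_eq_mul, nsmul_eq_mul, MvPolynomial.smul_eq_C_mul, map_mul, map_natCast]
      rcases Nat.eq_zero_or_pos (e a) with h0 | hpos
      · simp [h0]
      · have hX : (X (Sum.inr a) : MvPolynomial (Fin d₀ ⊕ Fin d₁) ℂ) ^ e a =
            X (Sum.inr a) ^ (e a - 1) * X (Sum.inr a) := by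
          rw [← pow_succ, Nat.sub_add_cancel hpos]
        rw [hX]
        ring
  exact key Finset.univ

/-- The character binomial `Y^{χ⁺} - ζ·Y^{χ⁻}` whose zero set in `G` is `{y^χ = ζ}`
(`LinGroup.evalAt_charPoly_eq_zero_iff`). [folklore] -/
def charBinomial (χ : Fin d₁ → ℤ) (ζ : ℂ) : MvPolynomial (Fin d₀ ⊕ Fin d₁) ℂ :=
  ∏ j, X (Sum.inr j) ^ (χ j).toNat - C ζ * ∏ j, X (Sum.inr j) ^ (-χ j).toNat

/-- The linear form `⟨χ, v⟩ = ∑ χ_j v_j` of a character on `Lie G = ℂ^{d₀} × ℂ^{d₁}`. [folklore] -/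
def charForm (χ : Fin d₁ → ℤ) : ((Fin d₀ → ℂ) × (Fin d₁ → ℂ)) →ₗ[ℂ] ℂ where
  toFun w := ∑ j, (χ j : ℂ) * w.2 j
  map_add' w w' := by simp [mul_add, Finset.sum_add_distrib]
  map_smul' c w := by simp [Finset.mul_sum, mul_left_comm]

/-- Unfolding `charForm`. [folklore] -/
theorem charForm_apply (χ : Fin d₁ → ℤ) (w : (Fin d₀ → ℂ) × (Fin d₁ → ℂ)) : charForm χ w = ∑ j, (χ j : ℂ) * w.2 j := rfl

/-- **`D_w (Y^{χ⁺} - ζY^{χ⁻}) - ⟨χ, v⟩·Y^{χ⁺}` is a multiple of `Y^{χ⁺} - ζY^{χ⁻}`.** [folklore] -/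
theorem invDeriv_charBinomial_sub_eq (w : (Fin d₀ → ℂ) × (Fin d₁ → ℂ)) (χ : Fin d₁ → ℤ) (ζ : ℂ) :
    invDeriv w (charBinomial χ ζ) - charForm χ w • ∏ j, (X (Sum.inr j) : MvPolynomial (Fin d₀ ⊕ Fin d₁) ℂ) ^ (χ j).toNat =
      (∑ j, ((-χ j).toNat : ℂ) * w.2 j) • charBinomial χ ζ := by
  unfold charBinomial
  have e1 : C ζ * ∏ j, (X (Sum.inr j) : MvPolynomial (Fin d₀ ⊕ Fin d₁) ℂ) ^ (-χ j).toNat =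
      ζ • ∏ j, (X (Sum.inr j) : MvPolynomial (Fin d₀ ⊕ Fin d₁) ℂ) ^ (-χ j).toNat := (MvPolynomial.smul_eq_C_mul _ ζ).symm
  rw [e1, map_sub, Derivation.map_smul, invDeriv_prod_X_pow, invDeriv_prod_X_pow, charForm_apply]
  have hχ : ∀ j, (χ j : ℂ) = ((χ j).toNat : ℂ) - ((-χ j).toNat : ℂ) := fun j => by
    have h : ((χ j).toNat : ℤ) - ((-χ j).toNat : ℤ) = χ j := Int.toNat_sub_toNat_neg (χ j)
    have h2 : (χ j : ℂ) = ((((χ j).toNat : ℤ) - ((-χ j).toNat : ℤ) : ℤ) : ℂ) := by rw [h]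
    rw [h2]
    push_cast
    ring
  simp only [hχ, sub_mul, Finset.sum_sub_distrib, MvPolynomial.smul_eq_C_mul, map_sub, map_sum, map_mul,
    map_natCast, smul_sub]
  ring

section Transversal

variable (H₀ : Subgroup (LinGroup d₀ d₁)) (hirr : IsIrred (H₀ : Set (LinGroup d₀ d₁))) (σ : LinGroup d₀ d₁)

/-- Points of the coset `σ·H₀`. [folklore] -/
theorem mem_smul_coset_iff {g : LinGroup d₀ d₁} : g ∈ σ • (H₀ : Set (LinGroup d₀ d₁)) ↔ ∃ h ∈ H₀, g = σ * h := by
  rw [Set.mem_smul_set]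
  constructor
  · rintro ⟨h, hh, rfl⟩; exact ⟨h, hh, rfl⟩
  · rintro ⟨h, hh, rfl⟩; exact ⟨h, hh, rfl⟩

/-- A `Y`-monomial does not vanish on a coset. [folklore] -/
theorem prod_X_pow_notMem_vanishing (e : Fin d₁ → ℕ) :
    (∏ j, (X (Sum.inr j) : MvPolynomial (Fin d₀ ⊕ Fin d₁) ℂ) ^ e j) ∉ vanishing (σ • (H₀ : Set (LinGroup d₀ d₁))) := by
  intro h
  have h1 := h σ ((mem_smul_coset_iff H₀ σ).mpr ⟨1, H₀.one_mem, by simp⟩)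
  rw [evalAt_eq_eval] at h1
  simp only [map_prod, map_pow, MvPolynomial.eval_X, coord_inr] at h1
  exact (Finset.prod_ne_zero_iff.mpr fun j _ => pow_ne_zero _ (σ.2 j).ne_zero) h1

/-- The linear form `w ↦ ∑ φᵢ w₀ᵢ` on `Lie G` attached to a covector `φ` of the additive factor.
[folklore] -/
def annForm (φ : Fin d₀ → ℂ) : ((Fin d₀ → ℂ) × (Fin d₁ → ℂ)) →ₗ[ℂ] ℂ where
  toFun w := ∑ i, φ i * w.1 i
  map_add' w w' := by simp [mul_add, Finset.sum_add_distrib]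
  map_smul' c w := by simp [Finset.mul_sum, mul_left_comm]

/-- Unfolding `annForm`. [folklore] -/
theorem annForm_apply (φ : Fin d₀ → ℂ) (w : (Fin d₀ → ℂ) × (Fin d₁ → ℂ)) : annForm (d₁ := d₁) φ w = ∑ i, φ i * w.1 i := rfl

/-- **Double annihilator in coordinates**: `x ∈ E` iff every covector killing `E` kills `x`.
[folklore] -/
theorem mem_iff_forall_annihilator (E : Submodule ℂ (Fin d₀ → ℂ)) (x : Fin d₀ → ℂ) :
    x ∈ E ↔ ∀ φ : Fin d₀ → ℂ, (∀ y ∈ E, ∑ i, φ i * y i = 0) → ∑ i, φ i * x i = 0 := by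
  constructor
  · intro hx φ hφ; exact hφ x hx
  · intro h
    by_contra hx
    obtain ⟨f, hfx, hfE⟩ := Submodule.exists_dual_map_eq_bot_of_notMem hx inferInstance
    have hexp : ∀ y : Fin d₀ → ℂ, f y = ∑ i, f (Pi.single i 1) * y i := fun y => by
      rw [LinearMap.pi_apply_eq_sum_univ f y]
      refine Finset.sum_congr rfl fun i _ => ?_
      rw [smul_eq_mul, mul_comm]
      congr 2
      funext j
      by_cases hij : i = j
      · subst hij; simp
      · rw [if_neg hij, Pi.single_eq_of_ne' hij]
    apply hfx
    rw [hexp]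
    refine h _ fun y hy => ?_
    rw [← hexp]
    have : f y ∈ E.map f := Submodule.mem_map_of_mem hy
    rwa [hfE, Submodule.mem_bot] at this

include hirr in
/-- The additive equation `∑ φᵢ (Xᵢ - xᵢ(σ))` vanishes on `σ·H₀` when the covector `φ` kills the
additive part `E` of `H₀`. [folklore] -/
theorem annPoly_mem_vanishing {φ : Fin d₀ → ℂ}
    (hφ : ∀ x ∈ (toConnAlgSubgroup H₀ hirr).addPart, ∑ i, φ i * x i = 0) :
    (∑ i, C (φ i) * (X (Sum.inl i) - C (Multiplicative.toAdd σ.1 i)) : MvPolynomial (Fin d₀ ⊕ Fin d₁) ℂ) ∈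
      vanishing (σ • (H₀ : Set (LinGroup d₀ d₁))) := by
  intro g hg
  obtain ⟨h, hh, rfl⟩ := (mem_smul_coset_iff H₀ σ).mp hg
  have hh1 : Multiplicative.toAdd h.1 ∈ (toConnAlgSubgroup H₀ hirr).addPart := by
    have hmem : h ∈ (toConnAlgSubgroup H₀ hirr).toSubgroup := by rwa [toSubgroup_toConnAlgSubgroup]
    exact hmem.1
  rw [evalAt_eq_eval]
  simp only [map_sum, map_mul, map_sub, MvPolynomial.eval_C, MvPolynomial.eval_X, coord_inl, Prod.fst_mul,
    toAdd_mul, Pi.add_apply, add_sub_cancel_left]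
  exact hφ _ hh1

/-- The derivative of the additive equation is the constant `∑ φᵢ w₀ᵢ`. [folklore] -/
theorem invDeriv_annPoly (w : (Fin d₀ → ℂ) × (Fin d₁ → ℂ)) (φ : Fin d₀ → ℂ) :
    invDeriv w (∑ i, C (φ i) * (X (Sum.inl i) - C (Multiplicative.toAdd σ.1 i)) : MvPolynomial (Fin d₀ ⊕ Fin d₁) ℂ) =
      C (annForm (d₁ := d₁) φ w) := by
  simp only [map_sum, Derivation.leibniz, map_sub, invDeriv_X_inl, invDeriv_C, sub_zero, mul_zero, add_zero,
    smul_eq_mul, annForm_apply, map_mul]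

/-- The character binomial `Y^{χ⁺} - χ(σ) Y^{χ⁻}` vanishes on `σ·H₀` for `χ` trivial on `H₀`.
[folklore] -/
theorem charBinomial_mem_vanishing {χ : Fin d₁ → ℤ} (hχ : χ ∈ charGroup (H₀ : Set (LinGroup d₀ d₁))) :
    charBinomial χ ((∏ j, (σ.2 j) ^ (χ j) : ℂˣ) : ℂ) ∈ vanishing (σ • (H₀ : Set (LinGroup d₀ d₁))) := by
  intro g hg
  obtain ⟨h, hh, rfl⟩ := (mem_smul_coset_iff H₀ σ).mp hg
  unfold charBinomial
  rw [evalAt_charPoly_eq_zero_iff]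
  have h1 : ∏ j, (h.2 j) ^ (χ j) = 1 := hχ h hh
  simp only [Prod.snd_mul, Pi.mul_apply, mul_zpow, Finset.prod_mul_distrib, h1, mul_one]

include hirr in
/-- **Prop. 3.8, Step 2: transversal data at a coset.** For an irreducible closed subgroup `H₀`,
`σ ∈ G` and a subspace `W` of `Lie G`, with `s = dim W - dim (W ∩ Lie H₀)`, there are
`w₁, …, w_s ∈ W` and `g₁, …, g_s ∈ 𝔭 = 𝔍(σ·H₀)`, all in one box `Box(c)`, with
`D_{wᵢ} g_j ∈ 𝔭` for `i ≠ j` and `D_{wᵢ} gᵢ ∉ 𝔭`.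
[cite: NesterenkoPhilippon2001, Ch. 11 Prop. 3.8 (Step 2)] -/
theorem exists_transversal {D₀ D₁ : ℕ} (hD₀ : 1 ≤ D₀) (hD₁ : 1 ≤ D₁) (W : Submodule ℂ ((Fin d₀ → ℂ) × (Fin d₁ → ℂ))) :
    ∃ (c : ℕ) (w : Fin (finrank ℂ W - finrank ℂ ↥(W ⊓ (toConnAlgSubgroup H₀ hirr).tangent)) → (Fin d₀ → ℂ) × (Fin d₁ → ℂ))
      (g : Fin (finrank ℂ W - finrank ℂ ↥(W ⊓ (toConnAlgSubgroup H₀ hirr).tangent)) → MvPolynomial (Fin d₀ ⊕ Fin d₁) ℂ),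
      (∀ i, w i ∈ W) ∧ (∀ j, g j ∈ vanishing (σ • (H₀ : Set (LinGroup d₀ d₁)))) ∧
      (∀ j, g j ∈ Box (d₀ := d₀) (d₁ := d₁) D₀ D₁ c) ∧
      (∀ i j, i ≠ j → invDeriv (w i) (g j) ∈ vanishing (σ • (H₀ : Set (LinGroup d₀ d₁)))) ∧
      (∀ i, invDeriv (w i) (g i) ∉ vanishing (σ • (H₀ : Set (LinGroup d₀ d₁)))) := by
  classical
  set K := toConnAlgSubgroup H₀ hirr with hK
  set 𝔭 := vanishing (σ • (H₀ : Set (LinGroup d₀ d₁))) with h𝔭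
  have h𝔭ne : 𝔭 ≠ ⊤ := vanishing_ne_top ⟨σ, (mem_smul_coset_iff H₀ σ).mpr ⟨1, H₀.one_mem, by simp⟩⟩
  -- the linear forms on `W`
  let ℓa : (Fin d₀ → ℂ) → (↥W →ₗ[ℂ] ℂ) := fun φ => (annForm φ).comp W.subtype
  let ℓ : (Fin d₁ → ℤ) → (↥W →ₗ[ℂ] ℂ) := fun χ => (charForm χ).comp W.subtype
  let 𝓛 : Set (↥W →ₗ[ℂ] ℂ) :=
    {l | (∃ φ : Fin d₀ → ℂ, (∀ y ∈ K.addPart, ∑ i, φ i * y i = 0) ∧ l = ℓa φ) ∨ ∃ χ ∈ K.chars, l = ℓ χ}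
  set T : Submodule ℂ ↥W := K.tangent.comap W.subtype with hT
  have hTmem : ∀ v : ↥W, v ∈ T ↔ ∀ l ∈ 𝓛, l v = 0 := by
    intro v
    rw [hT, Submodule.mem_comap, Submodule.coe_subtype, ConnAlgSubgroup.tangent, Submodule.mem_prod]
    constructor
    · rintro ⟨h1, h2⟩ l hl
      rcases hl with ⟨φ, hφ, rfl⟩ | ⟨χ, hχ, rfl⟩
      · exact hφ _ h1
      · exact h2 χ hχ
    · intro h
      refine ⟨?_, fun χ hχ => h (ℓ χ) (Or.inr ⟨χ, hχ, rfl⟩)⟩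
      rw [mem_iff_forall_annihilator]
      intro φ hφ
      exact h (ℓa φ) (Or.inl ⟨φ, hφ, rfl⟩)
  have hTrank : finrank ℂ T = finrank ℂ ↥(W ⊓ K.tangent) := by
    have e : T = (W ⊓ K.tangent).comap W.subtype := by
      rw [hT, Submodule.comap_inf, Submodule.comap_subtype_self, top_inf_eq]
    rw [e]
    exact (Submodule.comapSubtypeEquivOfLe (inf_le_left : W ⊓ K.tangent ≤ W)).finrank_eq
  have hs : (finrank ℂ W - finrank ℂ ↥(W ⊓ K.tangent)) + finrank ℂ T ≤ finrank ℂ ↥W := by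
    rw [hTrank]
    have := Submodule.finrank_mono (inf_le_left : W ⊓ K.tangent ≤ W)
    omega
  obtain ⟨lam, v, hlam, hdual⟩ := GaGm.exists_dual_family 𝓛 T hTmem _ hs
  -- the equations attached to the chosen forms
  have hdata : ∀ j, ∃ (gj Uj : MvPolynomial (Fin d₀ ⊕ Fin d₁) ℂ), gj ∈ 𝔭 ∧ Uj ∉ 𝔭 ∧
      ∀ u : ↥W, invDeriv (u : (Fin d₀ → ℂ) × (Fin d₁ → ℂ)) gj - (lam j u) • Uj ∈ 𝔭 := by
    intro j
    rcases hlam j with ⟨φ, hφ, hj⟩ | ⟨χ, hχ, hj⟩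
    · refine ⟨∑ i, C (φ i) * (X (Sum.inl i) - C (Multiplicative.toAdd σ.1 i)), 1, annPoly_mem_vanishing H₀ hirr σ hφ,
        fun h => h𝔭ne ((Ideal.eq_top_iff_one _).mpr h), fun u => ?_⟩
      rw [hj, invDeriv_annPoly, MvPolynomial.smul_eq_C_mul, mul_one]
      change C (annForm φ (u : (Fin d₀ → ℂ) × (Fin d₁ → ℂ))) - C (annForm φ (u : (Fin d₀ → ℂ) × (Fin d₁ → ℂ))) ∈ 𝔭
      rw [sub_self]; exact 𝔭.zero_mem
    · have hχ' : χ ∈ charGroup (H₀ : Set (LinGroup d₀ d₁)) := hχ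
      refine ⟨charBinomial χ ((∏ j, (σ.2 j) ^ (χ j) : ℂˣ) : ℂ), ∏ j, X (Sum.inr j) ^ (χ j).toNat,
        charBinomial_mem_vanishing H₀ σ hχ', prod_X_pow_notMem_vanishing H₀ σ _, fun u => ?_⟩
      rw [hj, show ℓ χ u = charForm χ (u : (Fin d₀ → ℂ) × (Fin d₁ → ℂ)) from rfl, invDeriv_charBinomial_sub_eq,
        MvPolynomial.smul_eq_C_mul]
      exact 𝔭.mul_mem_left _ (charBinomial_mem_vanishing H₀ σ hχ')
  choose g U hg hU hD using hdata
  refine ⟨Finset.univ.sup fun j => (g j).totalDegree, fun i => (v i : (Fin d₀ → ℂ) × (Fin d₁ → ℂ)), g,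
    fun i => (v i).2, hg, fun j => Box_mono (Finset.le_sup (Finset.mem_univ j)) (mem_Box_totalDegree hD₀ hD₁ _),
    fun i j hij => ?_, fun i => ?_⟩
  · have h := hD j (v i)
    rw [hdual i j, if_neg hij, zero_smul, sub_zero] at h
    exact h
  · intro hmem
    have h := hD i (v i)
    rw [hdual i i, if_pos rfl, one_smul] at h
    exact hU i (by simpa using 𝔭.sub_mem hmem h)

end Transversal

end LinGroup

end Literature.NumberTheory.Transcendental
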